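import Mathlib
import HarnessLib
import Summits.HubbardSuperconductivity.HubbardSuperconductivity.Theorems.KLProgrammeKLRegimeTwoVolumeLipDefectSizes
import Summits.HubbardSuperconductivity.HubbardSuperconductivity.Theorems.KLProgrammeKLRegimeTwoVolumeDefectStepGraded
import Summits.HubbardSuperconductivity.HubbardSuperconductivity.Theorems.KLProgrammeKLRegimeEngineTowerBlockIncrWt
import Summits.HubbardSuperconductivity.HubbardSuperconductivity.Theorems.KLProgrammeKLRegimeWickEffectiveActionLegDressing

/-!
# Route `KLProgramme` — crux K3 ENGINE (stmt-HubbardSuperconductivity-20437), stub (e) proof-input «(e)-D-ROWS», F-D5b (step): THE COVARIANCE-DEFECT SOURCE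
# OF BLOCK `k` AT A DEEP PIN — `…TwoVolumeDefectStepGraded` at the objects of `…TwoVolumeLipDefectDefs`, structural hypotheses discharged
# (seat hubbard-kl-k3c4-p1 g23; `--supports` 20437; DROWS-SCOPE-g23 §9.2/§9.4 F-D5b)

The source defect of block `k` (`…LipSourceSplit.lipSourceDefect_eq`, `…LipDefectDefs.lipSourceDefect_eq_defectStep`) is
`effAction (C^cop + D_n + D_f) G − effAction C^cop G` on the fine analysed labels `Γ_k(bL)`, `G = klGlue (klLipInput L …)`, `C^cop = klCopiesCov (klLipCov L …)`,
`D_n/D_f = klLipDefectNear/Far … R`.  Here the GRADED defect step `…TwoVolumeDefectStepGraded.sum_norm_kernel_twoVolumeDefect_le_graded` is instantiated at these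
objects with every STRUCTURAL hypothesis discharged: parity / constant part of `G` (from `Z^K_{L,Λ_{dk}} ≠ 0`), the unit `Z(C^cop, G)` (copies of `Z(C′_L, D_L)`:
`isUnit_effPartitionFn_klCopiesCov_klGlue` ∘ `isUnit_effPartitionFn_klLipCov_klLipInput`, from `Z^K_{L,Λ_{dk}}, Z^K_{L,Λ_{d(k+1)}} ≠ 0`), the support of `D_f` on the
zone `{not R-deep}` (`klLipDefectFar_apply_of_not_zone`), the sizes of `D_f` (`klLipDefectFar_norm_le/_row_le/_col_le` from sups / rows of the two block
covariances) and of `D_n` (`klLipDefectNear_norm_le/_row_le/_col_le` from the far row TAIL `T` of `klLipCov (bL)`), the distance-to-zone row of the pin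
(`…TwoVolumeTorusBlocks.far_of_not_deep_of_deep`: an `(R + R_f)`-deep pin is at distance `> R_f` from the zone), and the profile of the intermediate
`W = effAction C^cop G = klGlue (effAction C′_L D_L)` as the COARSE output profile (`klGlue_effAction` + `sum_pinned_norm_kernel_klGlue_eq`).  What remains named:
the Gram data of `D_n`, `D_f` (from charged Gram forms of the two block covariances — `…TwoVolumeBlockDefectGram`, (b) block constants), the one-volume profiles
(`Nf` coarse output, `Nn` of `W₁ = effAction D_f W`, uniform-in-`s` data of the Polchinski path) and the two smallness conditions.

* **`lipSourceDefect_le`** — the displayed instance (output degree `n+1`, leg `p` pinned at an `(R+R_f)`-deep fine label `w`).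

Composition of landed theorems; the decay tails / sups / rows / Gram data / profiles are hypotheses; nothing asserts the (D) rows, stub (e), VL, K3 or
superconductivity.  References: BGM 2006 (2.13)–(2.14), (2.77)–(2.90), §3 [cite: BenfattoGiulianiMastropietro2006]; Salmhofer 1998 §3.1 Prop. 1, §4.1.
-/

noncomputable section

namespace Summit.HubbardSuperconductivity.HubbardSuperconductivity.Theorems.TwoVolumeLip

set_option linter.dupNamespace false -- summit = problem name (single-conjunct summit), D-0017

open Finset Literature.MathematicalPhysics.QuantumLattice GrassmannAlgebra Literature.Probability.LatticeModels
open Literature.MathematicalPhysics.QuantumLattice.FermiRG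
open Summit.HubbardSuperconductivity.HubbardSuperconductivity.Theorems.KLRegimeSplit
open Summit.HubbardSuperconductivity.HubbardSuperconductivity.Theorems.KLProgrammeLegKernels
open Summit.HubbardSuperconductivity.HubbardSuperconductivity.Theorems.DispersionFlow
open Summit.HubbardSuperconductivity.HubbardSuperconductivity.Theorems.EngineV8
open Summit.HubbardSuperconductivity.HubbardSuperconductivity.Theorems.TwoVolumeSource
open Summit.HubbardSuperconductivity.HubbardSuperconductivity.Theorems.TwoVolumeDefect

variable {L b M : ℕ} [NeZero L] [NeZero (b * L)] [NeZero M]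

/-- **THE COVARIANCE-DEFECT SOURCE OF BLOCK `k` AT A DEEP PIN** (graded near bracket + far bracket, structural hypotheses discharged).  Block `k` with
`1 ≤ dk`, `β ≠ 0`; zone depth `R`, pin `w` `(R + R_f)`-deep; sups `s′, s`, rows `α′, α` of `klLipCov (bL)`, `klLipCov L`; far row tail `T > 0` of `klLipCov (bL)`
beyond `tnorm`-distance `R`; a charged Gram form `(q, f, g, κ_f)` of `D_f` and a Gram constant `κ_n` of `D_n` (block constants); profiles: `Nf` of the coarse block
output `effAction C′_L D_L` (unweighted, at residue pins), `Nn` of `W₁ := effAction D_f (klGlue (effAction C′_L D_L))`, uniform-in-`s` leg-`0` profiles / first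
moments `nV, mV, mL` of the Polchinski path; smallness `θ_f, θ_n < 1`; truncation `N₀ ≥ 2`; any `LinearOrder` on the fine labels (the far
step's bookkeeping order — route A's convention; the bound does not depend on it). -/
theorem lipSourceDefect_le {d k : ℕ} [LinearOrder (SpaceTimeIdx (b * L) M × SectorLeg (sectorCount (d * k - 1)))]
    {E : Type*} [NormedAddCommGroup E] [InnerProductSpace ℂ E] {β : ℝ} (hβ : β ≠ 0) (U μ : ℝ) (K : TrigPolyC4v) (hdk : 1 ≤ d * k) (R Rf : ℕ)
    (hZc : hubbardEffPartitionFnCT L M β U μ 0 K (klScale klE0 (d * k)) ≠ 0)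
    (hZc' : hubbardEffPartitionFnCT L M β U μ 0 K (klScale klE0 (d * (k + 1))) ≠ 0)
    -- FAR piece: charged Gram form (block constants), sups and rows of the two block covariances
    (q : SpaceTimeIdx (b * L) M × SectorLeg (sectorCount (d * k - 1)) → Bool)
    (hq : ∀ X Y, q X = q Y → klLipDefectFar L b M β μ K d k R X Y = 0) (f g : SpaceTimeIdx (b * L) M × SectorLeg (sectorCount (d * k - 1)) → E)
    {κf : ℝ} (hκf : 0 < κf) (hf : ∀ X, q X = true → ‖f X‖ ≤ κf) (hg : ∀ Y, q Y = false → ‖g Y‖ ≤ κf)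
    (hG : ∀ X Y, q X = true → q Y = false → contr ℂ (klLipDefectFar L b M β μ K d k R) X Y = inner ℂ (f X) (g Y))
    {s' s : ℝ} (hs'0 : 0 ≤ s') (hs0 : 0 ≤ s) (hs' : ∀ X' Y', ‖klLipCov (b * L) M β μ K d k X' Y'‖ ≤ s') (hs : ∀ X Y, ‖klLipCov L M β μ K d k X Y‖ ≤ s)
    {α' α : ℝ} (hαpos : 0 < α' + α)
    (hrow' : ∀ X', ∑ Y', ‖klLipCov (b * L) M β μ K d k X' Y'‖ ≤ α') (hrow : ∀ X, ∑ Y, ‖klLipCov L M β μ K d k X Y‖ ≤ α)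
    (hcol' : ∀ Y', ∑ X', ‖klLipCov (b * L) M β μ K d k X' Y'‖ ≤ α') (hcol : ∀ Y, ∑ X, ‖klLipCov L M β μ K d k X Y‖ ≤ α)
    -- the pin
    (w : SpaceTimeIdx (b * L) M × SectorLeg (sectorCount (d * k - 1))) (hw : w ∈ klDeepPins L (R + Rf))
    -- profile of the coarse block output (unweighted, every residue pin) and the far smallness
    (Nf : ℕ → ℝ) (hNf0 : ∀ m', 0 ≤ Nf m')
    (hNf : ∀ m' (j : Fin (2 * m')) (y : SpaceTimeIdx L M × SectorLeg (sectorCount (d * k - 1))),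
      ∑ Y ∈ univ.filter (fun Y : Fin (2 * m') → SpaceTimeIdx L M × SectorLeg (sectorCount (d * k - 1)) => Y j = y),
        ‖kernel ℂ (effAction ℂ (klLipCov L M β μ K d k) (klLipInput L M β U μ K d k)) (2 * m') Y‖ ≤ Nf m')
    {ρf : ℝ} (hρf : 0 < ρf)
    (hθf : Real.exp 1 * (α' + α) * normV (SpaceTimeIdx (b * L) M × SectorLeg (sectorCount (d * k - 1))) κf ρf Nf / κf ^ 2 < 1)
    -- uniform-in-`s` data of the Polchinski path `effAction (s • D_f) W`
    (nV mV mL : ℕ → ℝ) (hnV : ∀ m, 0 ≤ nV m) (hmV : ∀ m, 0 ≤ mV m)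
    (hVs0 : ∀ sP ∈ Set.Icc (0 : ℝ) 1, ∀ (m : ℕ) (x : SpaceTimeIdx (b * L) M × SectorLeg (sectorCount (d * k - 1))),
      ∑ Ut ∈ univ.filter (fun Ut : Fin (m + 1) → SpaceTimeIdx (b * L) M × SectorLeg (sectorCount (d * k - 1)) => Ut 0 = x),
        ‖kernel ℂ (effAction ℂ (sP • klLipDefectFar L b M β μ K d k R)
          (effAction ℂ (klCopiesCov L b M (sectorCount (d * k - 1)) (klLipCov L M β μ K d k))
            (klGlue L b M (sectorCount (d * k - 1)) (klLipInput L M β U μ K d k)))) (m + 1) Ut‖ ≤ nV (m + 1))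
    (hVsm : ∀ sP ∈ Set.Icc (0 : ℝ) 1, ∀ (m : ℕ) (i : Fin m),
      ∑ Ut ∈ univ.filter (fun Ut : Fin (m + 1) → SpaceTimeIdx (b * L) M × SectorLeg (sectorCount (d * k - 1)) => Ut i.succ = w),
        (Torus.tnorm ((Ut 0).1.2 - w.1.2) : ℝ) * ‖kernel ℂ (effAction ℂ (sP • klLipDefectFar L b M β μ K d k R)
          (effAction ℂ (klCopiesCov L b M (sectorCount (d * k - 1)) (klLipCov L M β μ K d k))
            (klGlue L b M (sectorCount (d * k - 1)) (klLipInput L M β U μ K d k)))) (m + 1) Ut‖ ≤ mV (m + 1))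
    (n : ℕ) (p : Fin (n + 1))
    (hVsL : ∀ sP ∈ Set.Icc (0 : ℝ) 1,
      ∑ Z ∈ univ.filter (fun Z : Fin (n + 1 + 1 + 1) → SpaceTimeIdx (b * L) M × SectorLeg (sectorCount (d * k - 1)) =>
          Z (Fin.castSucc (Fin.castSucc p)) = w),
        (Torus.tnorm ((Z (Fin.last (n + 1 + 1))).1.2 - w.1.2) : ℝ) * ‖kernel ℂ (effAction ℂ (sP • klLipDefectFar L b M β μ K d k R)
          (effAction ℂ (klCopiesCov L b M (sectorCount (d * k - 1)) (klLipCov L M β μ K d k))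
            (klGlue L b M (sectorCount (d * k - 1)) (klLipInput L M β U μ K d k)))) (n + 1 + 2) Z‖ ≤ mL (n + 3))
    -- NEAR piece: Gram constant (block constant), far row tail of the fine block covariance, profile of `W₁`, smallness, truncation
    {κn : ℝ} (hκn : 0 < κn) (hGBn : IsGramBoundedR (klLipDefectNear L b M β μ K d k R) κn)
    {T : ℝ} (hT0 : 0 < T)
    (hT : ∀ X' : SpaceTimeIdx (b * L) M × SectorLeg (sectorCount (d * k - 1)),
      ∑ Y' ∈ univ.filter (fun Y' : SpaceTimeIdx (b * L) M × SectorLeg (sectorCount (d * k - 1)) => R < Torus.tnorm (X'.1.2 - Y'.1.2)),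
        ‖klLipCov (b * L) M β μ K d k X' Y'‖ ≤ T)
    (Nn : ℕ → ℝ) (hNn0 : ∀ m', 0 ≤ Nn m')
    (hNn : ∀ (m' : ℕ) (j : Fin (2 * m')) (x : SpaceTimeIdx (b * L) M × SectorLeg (sectorCount (d * k - 1))),
      ∑ Z ∈ univ.filter (fun Z : Fin (2 * m') → SpaceTimeIdx (b * L) M × SectorLeg (sectorCount (d * k - 1)) => Z j = x),
        ‖kernel ℂ (effAction ℂ (klLipDefectFar L b M β μ K d k R)
          (effAction ℂ (klCopiesCov L b M (sectorCount (d * k - 1)) (klLipCov L M β μ K d k))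
            (klGlue L b M (sectorCount (d * k - 1)) (klLipInput L M β U μ K d k)))) (2 * m') Z‖ ≤ Nn m')
    {ρn : ℝ} (hρn : 0 < ρn)
    (hθn : Real.exp 1 * (2 * T) * normV (SpaceTimeIdx (b * L) M × SectorLeg (sectorCount (d * k - 1))) κn ρn Nn / κn ^ 2 < 1)
    {N₀ : ℕ} (hN₀ : 2 ≤ N₀) :
    ∑ X ∈ univ.filter (fun X : Fin (n + 1) → SpaceTimeIdx (b * L) M × SectorLeg (sectorCount (d * k - 1)) => X p = w),
        ‖kernel ℂ (effAction ℂ (klCopiesCov L b M (sectorCount (d * k - 1)) (klLipCov L M β μ K d k) + klLipDefectNear L b M β μ K d k R +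
              klLipDefectFar L b M β μ K d k R) (klGlue L b M (sectorCount (d * k - 1)) (klLipInput L M β U μ K d k))) (n + 1) X -
          kernel ℂ (effAction ℂ (klCopiesCov L b M (sectorCount (d * k - 1)) (klLipCov L M β μ K d k))
            (klGlue L b M (sectorCount (d * k - 1)) (klLipInput L M β U μ K d k))) (n + 1) X‖ ≤
      ((((n + 1 + 1) * (n + 1 + 2) : ℕ) : ℝ) / 2 * T *
          ∑ m' ∈ range (Fintype.card (SpaceTimeIdx (b * L) M × SectorLeg (sectorCount (d * k - 1))) / 2 + 1),
            (if n + 1 + 2 ≤ 2 * m' then ((2 * m').choose (n + 1 + 2) : ℝ) * κn ^ (2 * m' - (n + 1 + 2)) * Nn m' else 0) +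
        (∑ n' ∈ Ico 2 N₀, (ρn⁻¹ ^ (n + 1) * κn⁻¹ ^ (2 * (n' - 1)) * ((2 * T) ^ (n' - 1) * Real.exp n')) *
            ∑ δ ∈ (Fintype.piFinset fun _ : Fin n' => range (Fintype.card (SpaceTimeIdx (b * L) M × SectorLeg (sectorCount (d * k - 1))) / 2 + 1))
                with n + 1 + 2 * (n' - 1) ≤ ∑ a, 2 * δ a,
              ∏ a, (Real.exp 2 * (κn + ρn)) ^ (2 * δ a) * Nn (δ a) +
          ρn⁻¹ ^ (n + 1) * (Real.exp 1 * normV (SpaceTimeIdx (b * L) M × SectorLeg (sectorCount (d * k - 1))) κn ρn Nn) *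
            (Real.exp 1 * (2 * T) * normV (SpaceTimeIdx (b * L) M × SectorLeg (sectorCount (d * k - 1))) κn ρn Nn / κn ^ 2) ^ (N₀ - 1) /
              (1 - Real.exp 1 * (2 * T) * normV (SpaceTimeIdx (b * L) M × SectorLeg (sectorCount (d * k - 1))) κn ρn Nn / κn ^ 2))) +
        ((((n + 1 + 1) * (n + 1 + 2) : ℕ) : ℝ) / 2 * ((s' + s) / ((Rf : ℝ) + 1)) * mL (n + 3) +
          ‖(2 : ℂ)⁻¹‖ * ∑ a ∈ range (n + 2), ∑ b' ∈ range (n + 2),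
            (if a + b' = n + 1 then (((a + 1) * (b' + 1) : ℕ) : ℝ) *
              ((α' + α) * (mV (a + 1) / ((Rf : ℝ) + 1)) * nV (b' + 1) + (α' + α) * nV (a + 1) * (mV (b' + 1) / ((Rf : ℝ) + 1))) else 0)) := by
  classical
  -- the glued input: parity, constant part, unit
  have hDe : klLipInput L M β U μ K d k ∈ evenOdd ℂ 0 :=
    klLipInput_mem_evenOdd_zero (Summit.HubbardSuperconductivity.HubbardSuperconductivity.Theorems.KLRegimeWick.klEffectiveAction_mem_evenOdd_zero β U μ K klE0 (d * k))
  have hD0 : constPart ℂ (klLipInput L M β U μ K d k) = 0 := by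
    rw [constPart_klLipInput]; exact constPart_klEffectiveAction_eq_zero β U μ K klE0 (d * k) hZc
  have hGe : klGlue L b M (sectorCount (d * k - 1)) (klLipInput L M β U μ K d k) ∈ evenPart ℂ _ := klGlue_mem_evenOdd_zero hDe
  have hG0 : constPart ℂ (klGlue L b M (sectorCount (d * k - 1)) (klLipInput L M β U μ K d k)) = 0 := constPart_klGlue hD0
  have hZu := isUnit_effPartitionFn_klLipCov_klLipInput (V := L) hβ U μ K hdk hZc hZc'
  have hZC := isUnit_effPartitionFn_klCopiesCov_klGlue (L := L) (b := b) (klLipCov L M β μ K d k) hDe hD0 hZu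
  -- the intermediate `W = effAction C^cop G = klGlue (coarse output)` and its profile
  have hW : effAction ℂ (klCopiesCov L b M (sectorCount (d * k - 1)) (klLipCov L M β μ K d k))
      (klGlue L b M (sectorCount (d * k - 1)) (klLipInput L M β U μ K d k)) =
      klGlue L b M (sectorCount (d * k - 1)) (effAction ℂ (klLipCov L M β μ K d k) (klLipInput L M β U μ K d k)) :=
    (klGlue_effAction _ hDe hD0 hZu).symm
  have hNfW : ∀ m' (j : Fin (2 * m')) (x : SpaceTimeIdx (b * L) M × SectorLeg (sectorCount (d * k - 1))),
      ∑ Y ∈ univ.filter (fun Y : Fin (2 * m') → SpaceTimeIdx (b * L) M × SectorLeg (sectorCount (d * k - 1)) => Y j = x),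
        ‖kernel ℂ (effAction ℂ (klCopiesCov L b M (sectorCount (d * k - 1)) (klLipCov L M β μ K d k))
          (klGlue L b M (sectorCount (d * k - 1)) (klLipInput L M β U μ K d k))) (2 * m') Y‖ ≤ Nf m' := by
    intro m' j x
    rw [hW, sum_pinned_norm_kernel_klGlue_eq]
    exact hNf m' j _
  -- the far piece: support on the zone, sizes, distance of the pin
  have hfar : ∀ X Y, ¬ (X ∈ {Z' : SpaceTimeIdx (b * L) M × SectorLeg (sectorCount (d * k - 1)) | Z' ∉ klDeepPins L R} ∧
      Y ∈ {Z' : SpaceTimeIdx (b * L) M × SectorLeg (sectorCount (d * k - 1)) | Z' ∉ klDeepPins L R}) → klLipDefectFar L b M β μ K d k R X Y = 0 :=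
    fun X Y h => klLipDefectFar_apply_of_not_zone β μ K d k R X Y h
  have hsD := klLipDefectFar_norm_le (L := L) (b := b) β μ K d k R hs'0 hs0 hs' hs
  have hfrow := klLipDefectFar_row_le (L := L) (b := b) β μ K d k R hrow' hrow
  have hfcol := klLipDefectFar_col_le (L := L) (b := b) β μ K d k R hcol' hcol
  have hwd : ∀ j, R + Rf ≤ (w.1.2 j).val % L ∧ (w.1.2 j).val % L + (R + Rf) < L := mem_klDeepPins.1 hw
  have hdR : ∀ X : SpaceTimeIdx (b * L) M × SectorLeg (sectorCount (d * k - 1)),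
      X ∈ {Z' : SpaceTimeIdx (b * L) M × SectorLeg (sectorCount (d * k - 1)) | Z' ∉ klDeepPins L R} →
        (Rf : ℝ) + 1 ≤ (Torus.tnorm (X.1.2 - w.1.2) : ℝ) := by
    intro X hX
    rw [Set.mem_setOf_eq, mem_klDeepPins] at hX
    have h := far_of_not_deep_of_deep (d := 2) (M := b * L) (m := L) (b := b) rfl hX hwd
    exact_mod_cast Nat.succ_le_of_lt h
  -- the near piece: sizes from the far row tail
  have hsn := klLipDefectNear_norm_le (L := L) (b := b) hβ μ K d k R hT
  have hnrow := klLipDefectNear_row_le (L := L) (b := b) hβ μ K d k R hT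
  have hncol := klLipDefectNear_col_le (L := L) (b := b) hβ μ K d k R hT
  -- assemble
  have hmain := sum_norm_kernel_twoVolumeDefect_le_graded (klCopiesCov L b M (sectorCount (d * k - 1)) (klLipCov L M β μ K d k))
    (klLipDefectNear L b M β μ K d k R) (klLipDefectFar L b M β μ K d k R) _ hGe hG0 hZC q hq f g hκf hf hg hG hfar
    (add_nonneg hs'0 hs0) hsD hαpos hfrow hfcol (fun X => (Torus.tnorm (X.1.2 - w.1.2) : ℝ)) (fun X => Nat.cast_nonneg _) (by positivity) hdR w
    Nf hNf0 ?iNfW hρf hθf nV mV mL hnV hmV ?iVs0 ?iVsm n p ?iVsL hκn hGBn (by positivity) hnrow hncol hsn Nn hNn0 ?iNn hρn hθn hN₀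
  -- (the pinned data are re-read in the far step's `LinearOrder`-derived decidability instances, as in route A)
  case iNfW => intro m' j x; convert hNfW m' j x using 6
  case iVs0 => intro sP hsP m x; convert hVs0 sP hsP m x using 6
  case iVsm => intro sP hsP m i; convert hVsm sP hsP m i using 6
  case iVsL => intro sP hsP; convert hVsL sP hsP using 6
  case iNn => intro m' j x; convert hNn m' j x using 6
  convert hmain using 3

end Summit.HubbardSuperconductivity.HubbardSuperconductivity.Theorems.TwoVolumeLip

end
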